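/-
COR-CM (cell pub-hodgecm2, stage 2 of the Hodge ladder) — count-neutral KERNEL COMBINATORICS «the sheared dihedral family», part IVb: the dicyclic
index-two core (seat prover-pub-hodgecm2-b23-g52-0, binder prover b23, gen 52; claim «SYLOW TRANSFER XII + THE SHEARED DIHEDRAL FAMILY»,
HOME/INBOX.md l.23708).  Theorems only, on parts I/IV (`Census/ShearedDihedralDatum.lean`, `Census/ShearedDihedralCores.lean`) BY NAME; no
definition (the core is the Mathlib term `Subgroup.closure {g, s·x}`), no `decide`, no certificate, no named fact, no `sorry`; `Interfaces.lean` (C1),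
every E term, B01, `Transposition/*`, `PortJoin/*`, `D2Bridge/*` untouched.
HONEST FRAMING: `HC_CM` is NOT proved, here or anywhere in the tree; nothing here is a period, a count of record or a headline.
T5: n/a-class (hypothesis binders = the fields of `ShearedDihedral.Datum`; checker: self).
-/
import Summits.HodgeConjecture.CorCM.Census.ShearedDihedralCores

/-!
# The sheared dihedral family, IVb: the dicyclic core `⟨g, sx⟩ ≅ Dic_n`

For a sheared dihedral datum `D` on `(G, c)` (part I): `t := s x` has **`t² = c`** (`sx_mul_sx`) and **`t g t⁻¹ = g⁻¹`** (`sx_mul_g_mul_inv`), so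
`⟨g, sx⟩ = Subgroup.closure {g, s·x}` is a dicyclic group `Dic_n` of order `4n` and index two (`mem_closure_gsx_iff`: elements `gⁱ (sx)ᵉ`;
`card_closure_gsx`, `index_closure_gsx`), containing `c` and neither `x` nor `s` (`x_notMem_and_s_notMem_closure_gsx`) — the third input shape of
gen 46ʼs split index-two routes (involution `x` outside; b09ʼs quaternion column / gens 42–43ʼs dicyclic law give `μ(Dic_n) = β(Dic_n) − 1` lifts).
All [folklore].

## References
* [Pohlmann1968] H. Pohlmann, Algebraic cycles on abelian varieties of complex multiplication type, Ann. of Math. 88 (1968), Thm 1.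
-/

namespace Summit.HodgeConjecture.CorCM.Census.ShearedDihedral

open Finset

noncomputable section

variable {G : Type*} [Group G] [Fintype G] [DecidableEq G] {c : G} {n : ℕ}
variable (D : Datum G c n)

namespace Datum

include D

/-! ## §3 The dicyclic core `⟨g, sx⟩` -/

omit [Fintype G] [DecidableEq G] in
/-- **`(s x)² = c`.** [folklore] -/
theorem sx_mul_sx : D.s * D.x * (D.s * D.x) = c := by
  simpa only [pow_zero, one_mul] using D.pow_mul_s_mul_x_mul_self 0

omit [Fintype G] [DecidableEq G] in
/-- **`(s x) g (s x)⁻¹ = g⁻¹`**: `s x` inverts the rotations. [folklore] -/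
theorem sx_mul_g_mul_inv : D.s * D.x * D.g * (D.s * D.x)⁻¹ = D.g⁻¹ := by
  have hxinv : D.x⁻¹ = D.x := inv_eq_of_mul_eq_one_right D.hx2
  have hsinv : D.s⁻¹ = D.s := inv_eq_of_mul_eq_one_right D.hs2
  have h1 : D.x * D.g * D.x = D.g⁻¹ := by have h := D.hxg; rwa [hxinv] at h
  calc D.s * D.x * D.g * (D.s * D.x)⁻¹ = D.s * (D.x * D.g * D.x) * D.s := by rw [mul_inv_rev, hxinv, hsinv]; simp only [mul_assoc]
    _ = D.g⁻¹ * (D.s * D.s) := by rw [h1, ← (D.commute_g_s.inv_left).eq]; simp only [mul_assoc]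
    _ = D.g⁻¹ := by rw [D.hs2, mul_one]

omit [Fintype G] [DecidableEq G] in
/-- `(s x) gᶻ = g⁻ᶻ (s x)` for `z : ℤ`. [folklore] -/
theorem sx_mul_zpow (z : ℤ) : D.s * D.x * D.g ^ z = D.g ^ (-z) * (D.s * D.x) := by
  have h : D.s * D.x * D.g ^ z * (D.s * D.x)⁻¹ = D.g ^ (-z) := by
    rw [← MulAut.conj_apply, map_zpow, MulAut.conj_apply, D.sx_mul_g_mul_inv, inv_zpow, zpow_neg]
  rw [← h, inv_mul_cancel_right]

omit [DecidableEq G] in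
/-- **Membership in the dicyclic core**: `y ∈ ⟨g, sx⟩ ↔ y = gⁱ (sx)ᵉ` (`i < 2n`, `e < 2`). [folklore] -/
theorem mem_closure_gsx_iff (y : G) :
    y ∈ Subgroup.closure ({D.g, D.s * D.x} : Set G) ↔ ∃ i : ℕ, i < 2 * n ∧ ∃ e : ℕ, e < 2 ∧ y = D.g ^ i * (D.s * D.x) ^ e := by
  have hc : c ∈ Subgroup.zpowers D.g := by
    have h : D.g ^ n ∈ Subgroup.zpowers D.g := Subgroup.pow_mem _ (Subgroup.mem_zpowers _) n
    rwa [D.hgn] at h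
  obtain ⟨nc, hnc⟩ := Subgroup.mem_zpowers_iff.mp hc
  have hsx : D.s * D.x * (D.s * D.x) = D.g ^ nc := by rw [hnc]; exact D.sx_mul_sx
  constructor
  · intro hy
    let K : Subgroup G :=
      { carrier := {y | ∃ z : ℤ, ∃ e : ℕ, e < 2 ∧ y = D.g ^ z * (D.s * D.x) ^ e}
        one_mem' := ⟨0, 0, by norm_num, by rw [zpow_zero, pow_zero, mul_one]⟩
        mul_mem' := by
          rintro _ _ ⟨z₁, e₁, he₁, rfl⟩ ⟨z₂, e₂, he₂, rfl⟩
          obtain rfl | rfl : e₁ = 0 ∨ e₁ = 1 := by omega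
          · exact ⟨z₁ + z₂, e₂, he₂, by rw [pow_zero, mul_one, ← mul_assoc, ← zpow_add]⟩
          · obtain rfl | rfl : e₂ = 0 ∨ e₂ = 1 := by omega
            · refine ⟨z₁ - z₂, 1, by norm_num, ?_⟩
              calc D.g ^ z₁ * (D.s * D.x) ^ 1 * (D.g ^ z₂ * (D.s * D.x) ^ 0) = D.g ^ z₁ * ((D.s * D.x) * D.g ^ z₂) := by
                    simp only [pow_one, pow_zero, mul_one, mul_assoc]
                _ = D.g ^ (z₁ - z₂) * (D.s * D.x) ^ 1 := by rw [D.sx_mul_zpow, ← mul_assoc, ← zpow_add, pow_one, sub_eq_add_neg]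
            · refine ⟨z₁ - z₂ + nc, 0, by norm_num, ?_⟩
              calc D.g ^ z₁ * (D.s * D.x) ^ 1 * (D.g ^ z₂ * (D.s * D.x) ^ 1) = D.g ^ z₁ * ((D.s * D.x) * D.g ^ z₂) * (D.s * D.x) := by
                    simp only [pow_one, mul_assoc]
                _ = D.g ^ z₁ * (D.g ^ (-z₂) * (D.s * D.x)) * (D.s * D.x) := by rw [D.sx_mul_zpow]
                _ = D.g ^ z₁ * D.g ^ (-z₂) * (D.s * D.x * (D.s * D.x)) := by simp only [mul_assoc]
                _ = D.g ^ (z₁ - z₂ + nc) * (D.s * D.x) ^ 0 := by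
                    rw [hsx, ← zpow_add, ← zpow_add, pow_zero, mul_one, sub_eq_add_neg]
        inv_mem' := by
          rintro _ ⟨z, e, he, rfl⟩
          obtain rfl | rfl : e = 0 ∨ e = 1 := by omega
          · exact ⟨-z, 0, by norm_num, by rw [pow_zero, mul_one, mul_one, zpow_neg]⟩
          · refine ⟨z - nc, 1, by norm_num, ?_⟩
            -- `(gᶻ t)⁻¹ = t⁻¹ g⁻ᶻ = t g^{nc} g⁻ᶻ = g^{z − nc} t` with `t⁻¹ = t c = t g^{nc}`
            have htinv : (D.s * D.x)⁻¹ = D.s * D.x * D.g ^ nc := by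
              apply inv_eq_of_mul_eq_one_right
              rw [← mul_assoc, hsx, hnc, D.c_mul_c]
            rw [pow_one, mul_inv_rev, htinv, ← zpow_neg, mul_assoc, ← zpow_add, D.sx_mul_zpow, neg_add, neg_neg,
              neg_add_eq_sub] }
    have hle : Subgroup.closure ({D.g, D.s * D.x} : Set G) ≤ K := by
      rw [Subgroup.closure_le]
      rintro y (rfl | rfl)
      · exact ⟨1, 0, by norm_num, by rw [zpow_one, pow_zero, mul_one]⟩
      · exact ⟨0, 1, by norm_num, by rw [zpow_zero, pow_one, one_mul]⟩
    obtain ⟨z, e, he, rfl⟩ := hle hy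
    obtain ⟨i, hi, h⟩ := D.exists_pow_eq_zpow z
    exact ⟨i, hi, e, he, by rw [h]⟩
  · rintro ⟨i, -, e, -, rfl⟩
    exact mul_mem (Subgroup.pow_mem _ (Subgroup.subset_closure (by simp)) i)
      (Subgroup.pow_mem _ (Subgroup.subset_closure (by simp)) e)

/-- **`|⟨g, sx⟩| = 4n`.** [folklore] -/
theorem card_closure_gsx : Nat.card (Subgroup.closure ({D.g, D.s * D.x} : Set G)) = 4 * n := by
  classical
  set K := Subgroup.closure ({D.g, D.s * D.x} : Set G)
  let f : Fin (2 * n) × Fin 2 → G := fun t => D.g ^ (t.1 : ℕ) * D.s ^ (t.2 : ℕ) * D.x ^ (t.2 : ℕ)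
  have hf : ∀ t : Fin (2 * n) × Fin 2, f t = D.g ^ (t.1 : ℕ) * (D.s * D.x) ^ (t.2 : ℕ) := by
    rintro ⟨i, e⟩
    have he := e.2
    simp only [f]
    generalize (e : ℕ) = k at he ⊢
    interval_cases k
    · simp only [pow_zero, mul_one]
    · simp only [pow_one, mul_assoc]
  have hinj : Function.Injective f := by
    rintro ⟨i, e⟩ ⟨i', e'⟩ h
    obtain ⟨h1, -, h3⟩ := D.normalForm_inj i.2 i'.2 e.2 e'.2 e.2 e'.2 h
    ext <;> simp only [h1, h3]
  have himg : Finset.univ.filter (fun y : G => y ∈ K) = Finset.univ.image f := by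
    ext y
    simp only [Finset.mem_filter, Finset.mem_univ, true_and, Finset.mem_image]
    rw [D.mem_closure_gsx_iff]
    constructor
    · rintro ⟨i, hi, e, he, rfl⟩; exact ⟨(⟨i, hi⟩, ⟨e, he⟩), hf _⟩
    · rintro ⟨⟨i, e⟩, rfl⟩; exact ⟨i, i.2, e, e.2, (hf _)⟩
  rw [Nat.card_eq_fintype_card, Fintype.card_subtype, himg, Finset.card_image_of_injective _ hinj, Finset.card_univ,
    Fintype.card_prod, Fintype.card_fin, Fintype.card_fin]
  ring

/-- **`⟨g, sx⟩` has index two.** [folklore] -/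
theorem index_closure_gsx : (Subgroup.closure ({D.g, D.s * D.x} : Set G)).index = 2 := by
  have h := (Subgroup.closure ({D.g, D.s * D.x} : Set G)).card_mul_index
  rw [D.card_closure_gsx, D.hcard] at h
  have : 4 * n * (Subgroup.closure ({D.g, D.s * D.x} : Set G)).index = 4 * n * 2 := by rw [h]; ring
  refine Nat.eq_of_mul_eq_mul_left ?_ this
  have := Fintype.card_pos (α := G)
  have := D.card_eq_eight_mul
  omega

omit [Fintype G] [DecidableEq G] in
/-- `c ∈ ⟨g, sx⟩`. [folklore] -/
theorem c_mem_closure_gsx : c ∈ Subgroup.closure ({D.g, D.s * D.x} : Set G) := by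
  have h : D.g ^ n ∈ Subgroup.closure ({D.g, D.s * D.x} : Set G) := Subgroup.pow_mem _ (Subgroup.subset_closure (by simp)) n
  rwa [D.hgn] at h

omit [DecidableEq G] in
/-- **`x ∉ ⟨g, sx⟩`** and **`s ∉ ⟨g, sx⟩`**. [folklore] -/
theorem x_notMem_and_s_notMem_closure_gsx :
    D.x ∉ Subgroup.closure ({D.g, D.s * D.x} : Set G) ∧ D.s ∉ Subgroup.closure ({D.g, D.s * D.x} : Set G) := by
  have hn : 0 < 2 * n := by have := D.card_eq_eight_mul; have := Fintype.card_pos (α := G); omega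
  constructor
  · rw [D.mem_closure_gsx_iff]
    rintro ⟨i, hi, e, he, h⟩
    obtain rfl | rfl : e = 0 ∨ e = 1 := by omega
    · exact D.hx i 0 (by rw [h, pow_zero, pow_zero])
    · have h' : D.g ^ 0 * D.s ^ 0 * D.x ^ 1 = D.g ^ i * D.s ^ 1 * D.x ^ 1 := by
        simpa only [pow_zero, pow_one, one_mul, mul_assoc] using h
      obtain ⟨-, h2, -⟩ := D.normalForm_inj hn hi (by norm_num) (by norm_num) (by norm_num) (by norm_num) h'
      exact absurd h2 (by norm_num)
  · rw [D.mem_closure_gsx_iff]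
    rintro ⟨i, hi, e, he, h⟩
    obtain rfl | rfl : e = 0 ∨ e = 1 := by omega
    · exact D.hs (by rw [h, pow_zero, mul_one]; exact Subgroup.pow_mem _ (Subgroup.mem_zpowers _) i)
    · have h' : D.g ^ 0 * D.s ^ 1 * D.x ^ 0 = D.g ^ i * D.s ^ 1 * D.x ^ 1 := by
        simpa only [pow_zero, pow_one, one_mul, mul_one, mul_assoc] using h
      obtain ⟨-, -, h3⟩ := D.normalForm_inj hn hi (by norm_num) (by norm_num) (by norm_num) (by norm_num) h'
      exact absurd h3 (by norm_num)

end Datum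

end

end Summit.HodgeConjecture.CorCM.Census.ShearedDihedral
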